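import Mathlib.FieldTheory.KrullTopology
import Mathlib.FieldTheory.Galois.Profinite
import Mathlib.LinearAlgebra.Matrix.Permutation
import Literature.NumberTheory.GaloisRepresentations.FrobeniusDensityTheorem
import HarnessLib

/-!
# Closed subgroups containing the Frobenius elements (from Frobenius' density theorem)

Topic `Literature/NumberTheory/GaloisRepresentations`.  A *proofs* file (theorems only, no new
facts): an **unconditional** substitute, for homomorphisms, of the Chebotarev corollary
"Frobenius elements are dense in `Γ_K`" (`GaloisRepresentations/FrobeniusDensity.lean`, which is
conditional on the named fact `Literature.NumberTheory.Automorphic.chebotarev_artinRep`).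

Frobenius' density theorem (1896) — proved in the tree in its qualitative division form
`Literature.NumberTheory.GaloisRepresentations.FramedGaloisRep.infinite_setOf_frobenius_mem_division`
(`GaloisRepresentations/FrobeniusDensityTheorem.lean`; only input: the pole of `ζ_M` at `s = 1`
from Mathlib's class number formula residue) — does not separate the conjugacy classes of `g`
and of a generator `g^k`, `(k, ord g) = 1`, of the same cyclic group, so it does not give the
density of the Frobenius elements.  It does, however, give everything that is needed for
**characters and homomorphisms**: if a *subgroup* contains `Φ` and `g^n` and `Φ ≡ g^k` with
`(k, n) = 1`, it contains `g` (Bézout).  Hence: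

* `absoluteGaloisGroup.exists_framedGaloisRep_apply_eq_one_iff` — for a finite normal
  subextension `E ⊆ K̄`, a framed Artin representation `ρ : Γ_K → GL_N(ℂ)` with kernel *exactly*
  `Gal(K̄/E)` (the regular permutation representation of `Gal(E/K)`, as in
  `FrobeniusDensity.lean`, whose version only records `ρ φ = ρ g → φ|_E = g|_E`).
* `absoluteGaloisGroup.subgroup_eq_top_of_isClosed_of_frobenius_mem` — **a closed subgroup
  `H ≤ Γ_K` containing every arithmetic Frobenius element at the primes of `\bar ℤ_K` above the
  places `v ∉ S` (`S` finite) is all of `Γ_K`.**  Proof: if `g ∉ H`, the open set `g⁻¹ Hᶜ ∋ 1`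
  contains some `Gal(K̄/E)`, `E/K` finite normal (Krull topology); Frobenius' theorem for the
  Artin representation with kernel `U = Gal(K̄/E)` and `g` yields a good place `v ∉ S` with a
  Frobenius `Φ ∈ g^k U`, `(k, n) = 1`, `g^n ∈ U`; so `g ∈ H U` (Bézout in the subgroup
  `H ⊔ U = H · U`, `U` normal), i.e. `g u ∈ H` for some `u ∈ U` — contradicting `g U ∩ H = ∅`.
* `absoluteGaloisGroup.monoidHom_eq_of_frobenius` — **two continuous homomorphisms from `Γ_K`
  to a Hausdorff topological monoid/group which agree at every arithmetic Frobenius outside a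
  finite set of places are equal** (their equaliser is a closed subgroup), and the variant
  `absoluteGaloisGroup.monoidHom_eq_of_frobenius'` where continuity and the Hausdorff property
  are only asked of a further map `M → X` separating the values (e.g. `Units.val : Eˣ → E`).

These are exactly the uses of Chebotarev in Ribet 1977, Prop. (2.2) ("`det ρ_ℓ = ε χ_ℓ^{k−1}`
… by the Čebotarev density theorem") and Deligne–Serre 1974, proof of Thm. 4.1 (determinant),
now unconditional in the tree (consumer: `EllipticCurves/NewformGaloisRepDetProofs.lean`).

## References

* G. Frobenius, *Über Beziehungen zwischen den Primidealen eines algebraischen Körpers und den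
  Substitutionen seiner Gruppe*, S.-B. Preuss. Akad. Wiss. Berlin (1896), 689–703. [folklore]
* D. A. Marcus, *Number Fields*, 2nd ed., Springer 2018, Ch. 7, Exercise 12 (f) (the Frobenius
  Density Theorem) and Exercise 13 (applications to abelian extensions). [Marcus2018]
* J.-P. Serre, *Abelian ℓ-adic representations and elliptic curves* (1968), Ch. I §2.2,
  Cor. 2 (a) (the Chebotarev form: Frobenius elements are dense). [SerreAbelianLadic1968]

## Design notes

* No named fact is used: the file is Chebotarev-free and class-field-theory-free.
* `absoluteGaloisGroup K` is Mathlib's non-reducible `Field.absoluteGaloisGroup`; subgroups of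
  `K̄ ≃ₐ[K] K̄` such as `E.fixingSubgroup` are used at type `Subgroup (absoluteGaloisGroup K)`
  by definitional unfolding, as in `ArtinRestriction.lean` (`mem_fixingSubgroup_iff_forall_smul`).
-/

noncomputable section

open scoped NumberField Topology Pointwise
open IsDedekindDomain Field

namespace Literature.NumberTheory.GaloisRepresentations

/-! ### A faithful Artin representation of `Gal(E/K)` with kernel exactly `Gal(K̄/E)` -/

section Artin

variable {K : Type*} [Field K]

/-- **A framed Artin representation of `Γ_K` with kernel exactly `Gal(K̄/E)`**, for a finite
normal subextension `E ⊆ K̄`: the regular permutation representation of the finite group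
`Gal(E/K)` on `Fin #Gal(E/K)` by permutation matrices (Mathlib `MulAction.toPermHom`,
`Equiv.permCongrHom`, `Matrix.permMatrixHom`; faithful), inflated along the continuous
restriction `Γ_K → Gal(E/K)` (Mathlib `AlgEquiv.restrictNormalHom`,
`InfiniteGalois.restrictNormalHom_continuous`).  So `ρ φ = 1 ↔ φ|_E = 1 ↔ φ ∈ Gal(K̄/E)`.
[folklore] -/
theorem absoluteGaloisGroup.exists_framedGaloisRep_apply_eq_one_iff
    (E : IntermediateField K (AlgebraicClosure K)) [FiniteDimensional K E] [Normal K E] :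
    ∃ (N : ℕ) (ρ : FramedGaloisRep K ℂ N), ∀ φ : absoluteGaloisGroup K,
      ρ φ = 1 ↔ φ ∈ (E.fixingSubgroup : Subgroup (absoluteGaloisGroup K)) := by
  classical
  -- the regular permutation representation `π` of `G = Gal(E/K)` on `Fin #G`, faithful
  let e := Fintype.equivFin (E ≃ₐ[K] E)
  let π : (E ≃ₐ[K] E) →* GL (Fin (Fintype.card (E ≃ₐ[K] E))) ℂ :=
    ((Matrix.permMatrixHom (R := ℂ)).comp
      (e.permCongrHom.toMonoidHom.comp (MulAction.toPermHom (E ≃ₐ[K] E) (E ≃ₐ[K] E)))).toHomUnits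
  have hπ : Function.Injective π := by
    intro g h hgh
    have h1 := congrArg Units.val hgh
    simp only [π, MonoidHom.coe_toHomUnits, MonoidHom.coe_comp, Function.comp_apply,
      Matrix.permMatrixHom_apply, MulEquiv.coe_toMonoidHom] at h1
    have h2 := PEquiv.toMatrix_injective h1
    have h3 : e.permCongrHom (MulAction.toPermHom _ _ g) =
        e.permCongrHom (MulAction.toPermHom _ _ h) := by
      refine inv_injective (Equiv.ext fun x ↦ ?_)
      have hx := congrArg (fun f : PEquiv _ _ ↦ f x) h2
      simpa only [Equiv.toPEquiv_apply, Option.some.injEq] using hx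
    exact MulAction.toPerm_injective (e.permCongrHom.injective h3)
  -- the restriction `Γ_K → Gal(E/K)`, continuous (Krull topologies; the target is discrete)
  let r : absoluteGaloisGroup K →* (E ≃ₐ[K] E) :=
    (AlgEquiv.restrictNormalHom E).comp (absoluteGaloisGroup.toAlgEquiv K).toMonoidHom
  have hr : Continuous r := InfiniteGalois.restrictNormalHom_continuous (k := K) E
  have hρ : Continuous (π.comp r) := (continuous_of_discreteTopology (f := π)).comp hr
  refine ⟨Fintype.card (E ≃ₐ[K] E), ⟨π.comp r, hρ⟩, fun φ ↦ ?_⟩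
  have hr1 : r φ = 1 ↔ φ ∈ (E.fixingSubgroup : Subgroup (absoluteGaloisGroup K)) := by
    rw [mem_fixingSubgroup_iff_forall_smul]
    constructor
    · intro h x
      have hx := AlgEquiv.restrictNormalHom_apply E (absoluteGaloisGroup.toAlgEquiv K φ) x
      change (r φ x : AlgebraicClosure K) = _ at hx
      rw [h, AlgEquiv.one_apply] at hx
      rw [absoluteGaloisGroup.smul_def, ← hx]
    · intro h
      ext x
      have hx := AlgEquiv.restrictNormalHom_apply E (absoluteGaloisGroup.toAlgEquiv K φ) x
      change (r φ x : AlgebraicClosure K) = _ at hx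
      rw [hx, AlgEquiv.one_apply, ← absoluteGaloisGroup.smul_def]
      exact h x
  rw [← hr1]
  change π (r φ) = 1 ↔ r φ = 1
  exact map_eq_one_iff π hπ

end Artin

/-! ### Closed subgroups containing the Frobenius elements are everything -/

section Closed

variable {K : Type} [Field K] [NumberField K]

/-- **A closed subgroup of `Γ_K` containing all Frobenius elements is `Γ_K`** (unconditional,
from Frobenius' density theorem of 1896 in the division form
`FramedGaloisRep.infinite_setOf_frobenius_mem_division`; classically deduced from Chebotarev's
theorem, Serre 1968, Ch. I §2.2, Cor. 2 (a)).  Let `S` be a finite set of finite places of the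
number field `K` and `H ≤ Γ_K` a closed subgroup containing every `Φ ∈ Γ_K` which is an
arithmetic Frobenius (`IsArithFrobAt (𝓞 K) Φ 𝔓`) at some prime `𝔓` of `\bar ℤ_K` above some
`v ∉ S`.  Then `H = Γ_K`.  Proof: for `g ∉ H` choose a finite normal `E/K` with
`g · Gal(K̄/E) ∩ H = ∅` (`H` is closed; Krull topology), let `U = Gal(K̄/E)` (open, normal) and
`ρ` the Artin representation with kernel `U`; Frobenius' theorem gives `v ∉ S` and a Frobenius
`Φ` above `v` with `ρ Φ = ρ g^k`, `(k, n) = 1`, `n = ord ρ(g)`; then `Φ ∈ H`, `Φ g^{-k} ∈ U`,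
`g^n ∈ U`, so `g^k, g^n ∈ H ⊔ U` and `g ∈ H ⊔ U = H · U` by Bézout, i.e. `g u⁻¹ ∈ H` for some
`u ∈ U`: contradiction. [cite: Marcus2018, Ch. 7, Exercise 12 (f)] -/
theorem absoluteGaloisGroup.subgroup_eq_top_of_isClosed_of_frobenius_mem
    {S : Set (HeightOneSpectrum (𝓞 K))} (hS : S.Finite) {H : Subgroup (absoluteGaloisGroup K)}
    (hH : IsClosed (H : Set (absoluteGaloisGroup K)))
    (hFrob : ∀ v ∉ S, ∀ 𝔓 ∈ v.primesAbove, ∀ Φ : absoluteGaloisGroup K,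
      IsArithFrobAt (𝓞 K) Φ 𝔓 → Φ ∈ H) :
    H = ⊤ := by
  classical
  rw [Subgroup.eq_top_iff']
  intro g
  by_contra hg
  -- an open normal subgroup `U = Gal(K̄/E)` with `g U ∩ H = ∅`
  have hV : (fun τ : absoluteGaloisGroup K ↦ g * τ) ⁻¹' (H : Set (absoluteGaloisGroup K))ᶜ ∈
      𝓝 (1 : absoluteGaloisGroup K) := by
    refine (hH.isOpen_compl.preimage (continuous_const_mul g)).mem_nhds ?_
    simpa using hg
  obtain ⟨E, hfin, hnorm, hE⟩ :=
    (krullTopology_mem_nhds_one_iff_of_normal K (AlgebraicClosure K) _).1 hV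
  haveI := hfin
  haveI := hnorm
  obtain ⟨n, ρ, hρ⟩ := absoluteGaloisGroup.exists_framedGaloisRep_apply_eq_one_iff E
  set U : Subgroup (absoluteGaloisGroup K) := E.fixingSubgroup with hUdef
  haveI : IsGalois K E := ⟨⟩
  haveI hUn : U.Normal := (InfiniteGalois.normal_iff_isGalois E).mpr inferInstance
  have hker : IsOpen (ρ.toMonoidHom.ker : Set (absoluteGaloisGroup K)) := by
    have h1 : (ρ.toMonoidHom.ker : Set (absoluteGaloisGroup K)) = U := by
      ext φ
      exact hρ φ
    rw [h1]
    exact IntermediateField.fixingSubgroup_isOpen E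
  -- Frobenius' density theorem, division form, for `ρ` and `g`; discard the finite set `S`
  obtain ⟨v, ⟨-, 𝔓, h𝔓, Φ, hΦ, j, hj, hρΦ⟩, hvS⟩ :=
    ((FramedGaloisRep.infinite_setOf_frobenius_mem_division ρ hker g).sdiff hS).nonempty
  have hΦH : Φ ∈ H := hFrob v hvS 𝔓 h𝔓 Φ hΦ
  -- `g^j ∈ H ⊔ U`, `g^n ∈ U`, hence `g ∈ H ⊔ U` by Bézout
  have h1 : Φ * (g ^ j)⁻¹ ∈ U :=
    (hρ _).mp (by rw [map_mul, map_inv, hρΦ, map_pow, mul_inv_cancel])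
  have h2 : g ^ j ∈ H ⊔ U := by
    have : g ^ j = (Φ * (g ^ j)⁻¹)⁻¹ * Φ := by group
    rw [this]
    exact mul_mem (inv_mem (Subgroup.mem_sup_right h1)) (Subgroup.mem_sup_left hΦH)
  have h3 : g ^ orderOf (ρ g) ∈ H ⊔ U :=
    Subgroup.mem_sup_right ((hρ _).mp (by rw [map_pow, pow_orderOf_eq_one]))
  have h4 : g ∈ H ⊔ U := by
    obtain ⟨a, b, hab⟩ := Nat.isCoprime_iff_coprime.mpr hj
    have : g = (g ^ j) ^ a * (g ^ orderOf (ρ g)) ^ b := by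
      rw [← zpow_natCast, ← zpow_natCast, ← zpow_mul, ← zpow_mul, ← zpow_add,
        mul_comm (j : ℤ) a, mul_comm (orderOf (ρ g) : ℤ) b, hab, zpow_one]
    rw [this]
    exact mul_mem (Subgroup.zpow_mem _ h2 a) (Subgroup.zpow_mem _ h3 b)
  -- `H ⊔ U = H · U`: `g = h u`, so `g u⁻¹ = h ∈ H` with `u⁻¹ ∈ U` — contradiction
  have h5 : (g : absoluteGaloisGroup K) ∈ (H : Set (absoluteGaloisGroup K)) * (U : Set _) := by
    rw [← Subgroup.mul_normal H U]
    exact h4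
  obtain ⟨h, hh, u, hu, hhu⟩ := Set.mem_mul.mp h5
  have hu' : g * u⁻¹ ∉ H := hE (inv_mem hu : u⁻¹ ∈ U)
  apply hu'
  rw [← hhu, mul_inv_cancel_right]
  exact hh

/-- **Two continuous homomorphisms on `Γ_K` agreeing at the Frobenius elements are equal**
(unconditional; classically from Chebotarev, Serre 1968, Ch. I §2.2, Cor. 2 (a), e.g. Ribet
1977, Prop. (2.2)).  Let `M` be a Hausdorff topological monoid, `S` a finite set of finite
places of `K`, and `χ₁ χ₂ : Γ_K →* M` continuous with `χ₁ Φ = χ₂ Φ` for every arithmetic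
Frobenius `Φ` at every prime of `\bar ℤ_K` above every `v ∉ S`.  Then `χ₁ = χ₂`: the equaliser
`{χ₁ = χ₂}` is a closed subgroup (`MonoidHom.eqLocus`, `isClosed_eq`) containing the Frobenius
elements (`absoluteGaloisGroup.subgroup_eq_top_of_isClosed_of_frobenius_mem`).
[cite: Marcus2018, Ch. 7, Exercise 12 (f)] -/
theorem absoluteGaloisGroup.monoidHom_eq_of_frobenius {M : Type*} [Monoid M]
    [TopologicalSpace M] [T2Space M] {S : Set (HeightOneSpectrum (𝓞 K))} (hS : S.Finite)
    {χ₁ χ₂ : absoluteGaloisGroup K →* M} (h₁ : Continuous χ₁) (h₂ : Continuous χ₂)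
    (hFrob : ∀ v ∉ S, ∀ 𝔓 ∈ v.primesAbove, ∀ Φ : absoluteGaloisGroup K,
      IsArithFrobAt (𝓞 K) Φ 𝔓 → χ₁ Φ = χ₂ Φ) :
    χ₁ = χ₂ := by
  have htop : χ₁.eqLocus χ₂ = ⊤ :=
    absoluteGaloisGroup.subgroup_eq_top_of_isClosed_of_frobenius_mem hS
      (H := χ₁.eqLocus χ₂) (isClosed_eq h₁ h₂) hFrob
  exact MonoidHom.eq_of_eqOn_top fun x _ ↦ (htop ▸ Subgroup.mem_top x : x ∈ χ₁.eqLocus χ₂)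

/-- **Two homomorphisms on `Γ_K` agreeing at the Frobenius elements are equal**, variant in
which the topology is carried by an auxiliary injective-on-values map: `M` any monoid,
`f : M → X` to a Hausdorff space with `f ∘ χ₁`, `f ∘ χ₂` continuous and `f` injective (typical
use: `M = Eˣ`, `X = E`, `f = Units.val`, for characters with values in the units of a
topological field whose unit group one does not want to topologise).  If `χ₁ Φ = χ₂ Φ` at every
arithmetic Frobenius above every `v ∉ S` (`S` finite), then `χ₁ = χ₂`.
[cite: Marcus2018, Ch. 7, Exercise 12 (f)] -/
theorem absoluteGaloisGroup.monoidHom_eq_of_frobenius' {M X : Type*} [Monoid M]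
    [TopologicalSpace X] [T2Space X] {f : M → X} (hf : Function.Injective f)
    {S : Set (HeightOneSpectrum (𝓞 K))} (hS : S.Finite)
    {χ₁ χ₂ : absoluteGaloisGroup K →* M} (h₁ : Continuous (f ∘ χ₁)) (h₂ : Continuous (f ∘ χ₂))
    (hFrob : ∀ v ∉ S, ∀ 𝔓 ∈ v.primesAbove, ∀ Φ : absoluteGaloisGroup K,
      IsArithFrobAt (𝓞 K) Φ 𝔓 → χ₁ Φ = χ₂ Φ) :
    χ₁ = χ₂ := by
  have hcl : IsClosed ((χ₁.eqLocus χ₂ : Subgroup (absoluteGaloisGroup K)) :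
      Set (absoluteGaloisGroup K)) := by
    have h : ((χ₁.eqLocus χ₂ : Subgroup (absoluteGaloisGroup K)) : Set (absoluteGaloisGroup K)) =
        {x | (f ∘ χ₁) x = (f ∘ χ₂) x} := by
      ext x
      exact ⟨fun hx ↦ congrArg f hx, fun hx ↦ hf hx⟩
    rw [h]
    exact isClosed_eq h₁ h₂
  have htop : χ₁.eqLocus χ₂ = ⊤ :=
    absoluteGaloisGroup.subgroup_eq_top_of_isClosed_of_frobenius_mem hS
      (H := χ₁.eqLocus χ₂) hcl hFrob
  exact MonoidHom.eq_of_eqOn_top fun x _ ↦ (htop ▸ Subgroup.mem_top x : x ∈ χ₁.eqLocus χ₂)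

end Closed

end Literature.NumberTheory.GaloisRepresentations
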